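import Literature.Analysis.Complex.PickFunctions
import Literature.Analysis.InverseSpectral.KreinString
import HarnessLib

/-!
# Nevanlinna's kernel and the support of the representing measure

Auxiliary results towards the Stieltjes representation of Kreĭn's class `(S)` (Kac–Kreĭn 1974,
Supplement I, §S1.5): for a function given on the upper half-plane `Π` by Nevanlinna's formula

  `f(z) = b + c z + π⁻¹ ∫ (1/(t - z) - t/(1 + t²)) dμ(t)`,  `c ≥ 0`, `∫ dμ/(1+t²) < ∞`

(`Literature.Analysis.Complex.nevanlinna_representation`), we record the kernel algebra
`1/(t-z) - t/(1+t²) = (1 + tz)/((t - z)(1 + t²))`, its `μ`-integrability for `Im z ≠ 0`, the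
formula `Im f(x+iy) = c y + π⁻¹ ∫ y/((t-x)² + y²) dμ(t)`, the ball estimate
`μ([x-y, x+y]) ≤ 2πy · Im f(x+iy)`, and the **support lemma**: if `f` extends continuously and
real-valued to an open interval `I` of the real axis then `μ(I) = 0` (here for `I = (-∞, 0)`),
by the Vitali covering / density form of the inequality above. This is the part of the Stieltjes
inversion formula needed for Kreĭn's class `(S)`.

## References

KacKrein1974 (Supplement I, §S1.3–S1.5), RosenblumRovnyak1985 (Appendix §6, Theorems B, C).
-/

open MeasureTheory Filter Set Topology Metric
open scoped ENNReal NNReal ComplexConjugate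

noncomputable section

namespace Literature.Analysis.InverseSpectral

/-! ### The Nevanlinna kernel -/

/-- `1 + t² ≠ 0` in `ℂ` for real `t` (private copy of a helper also found in
`Literature.NumberTheory.Transcendental.KZ`). [folklore] -/
private lemma one_add_ofReal_sq_ne_zero (t : ℝ) : (1 : ℂ) + (t : ℂ) ^ 2 ≠ 0 := by
  have h : (1 : ℂ) + (t : ℂ) ^ 2 = ((1 + t ^ 2 : ℝ) : ℂ) := by push_cast; ring
  rw [h, Complex.ofReal_ne_zero]
  positivity

/-- `t - z ≠ 0` for real `t` and `Im z ≠ 0`. [folklore] -/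
lemma ofReal_sub_ne_zero {z : ℂ} (hz : z.im ≠ 0) (t : ℝ) : (t : ℂ) - z ≠ 0 := by
  intro h
  have := congrArg Complex.im h
  simp [hz] at this

/-- Kernel algebra: `1/(t-z) - t/(1+t²) = (1 + tz)/((t-z)(1+t²))` (`Im z ≠ 0`). [folklore] -/
lemma nevanlinnaKernel_eq {z : ℂ} (hz : z.im ≠ 0) (t : ℝ) :
    ((t : ℂ) - z)⁻¹ - (t : ℂ) / (1 + (t : ℂ) ^ 2) =
      (1 + (t : ℂ) * z) / (((t : ℂ) - z) * (1 + (t : ℂ) ^ 2)) := by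
  have h1 := ofReal_sub_ne_zero hz t
  have h2 := one_add_ofReal_sq_ne_zero t
  field_simp
  ring

/-- **Kernel bound**: `|1/(t-z) - t/(1+t²)| ≤ C_z (1+t²)⁻¹` with
`C_z = (1 + |z|²)/|Im z| + |z|` (`Im z ≠ 0`). [folklore] -/
lemma norm_nevanlinnaKernel_le {z : ℂ} (hz : z.im ≠ 0) (t : ℝ) :
    ‖((t : ℂ) - z)⁻¹ - (t : ℂ) / (1 + (t : ℂ) ^ 2)‖ ≤
      ((1 + ‖z‖ ^ 2) / |z.im| + ‖z‖) * (1 + t ^ 2)⁻¹ := by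
  rw [nevanlinnaKernel_eq hz, norm_div, norm_mul]
  have hy : 0 < |z.im| := abs_pos.2 hz
  have hd : |z.im| ≤ ‖(t : ℂ) - z‖ := by
    have h := Complex.abs_im_le_norm ((t : ℂ) - z)
    simpa using h
  have hd0 : 0 < ‖(t : ℂ) - z‖ := lt_of_lt_of_le hy hd
  have hsq : ‖(1 : ℂ) + (t : ℂ) ^ 2‖ = 1 + t ^ 2 := by
    have h : (1 : ℂ) + (t : ℂ) ^ 2 = ((1 + t ^ 2 : ℝ) : ℂ) := by push_cast; ring
    rw [h, Complex.norm_real, Real.norm_eq_abs, abs_of_pos (by positivity)]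
  rw [hsq]
  -- `|1 + tz| ≤ (1 + |z|²) + |z| |t - z|`
  have hnum : ‖1 + (t : ℂ) * z‖ ≤ (1 + ‖z‖ ^ 2) + ‖z‖ * ‖(t : ℂ) - z‖ := by
    have h1 : (1 : ℂ) + (t : ℂ) * z = 1 + z * z + ((t : ℂ) - z) * z := by ring
    rw [h1]
    calc ‖1 + z * z + ((t : ℂ) - z) * z‖ ≤ ‖1 + z * z‖ + ‖((t : ℂ) - z) * z‖ := norm_add_le _ _
      _ ≤ (‖(1 : ℂ)‖ + ‖z * z‖) + ‖((t : ℂ) - z) * z‖ := by gcongr; exact norm_add_le _ _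
      _ = (1 + ‖z‖ ^ 2) + ‖z‖ * ‖(t : ℂ) - z‖ := by rw [norm_mul, norm_mul, norm_one]; ring
  have hpos : 0 < ‖(t : ℂ) - z‖ * (1 + t ^ 2) := by positivity
  rw [div_le_iff₀ hpos]
  have key : ‖1 + (t : ℂ) * z‖ ≤ ((1 + ‖z‖ ^ 2) / |z.im| + ‖z‖) * ‖(t : ℂ) - z‖ := by
    calc ‖1 + (t : ℂ) * z‖ ≤ (1 + ‖z‖ ^ 2) + ‖z‖ * ‖(t : ℂ) - z‖ := hnum
      _ ≤ (1 + ‖z‖ ^ 2) / |z.im| * ‖(t : ℂ) - z‖ + ‖z‖ * ‖(t : ℂ) - z‖ := by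
          gcongr
          rw [div_mul_eq_mul_div, le_div_iff₀ hy]
          exact mul_le_mul_of_nonneg_left hd (by positivity)
      _ = ((1 + ‖z‖ ^ 2) / |z.im| + ‖z‖) * ‖(t : ℂ) - z‖ := by ring
  calc ‖1 + (t : ℂ) * z‖ ≤ ((1 + ‖z‖ ^ 2) / |z.im| + ‖z‖) * ‖(t : ℂ) - z‖ := key
    _ = ((1 + ‖z‖ ^ 2) / |z.im| + ‖z‖) * (1 + t ^ 2)⁻¹ * (‖(t : ℂ) - z‖ * (1 + t ^ 2)) := by
        field_simp

/-- The Nevanlinna kernel is continuous in `t`. [folklore] -/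
lemma continuous_nevanlinnaKernel {z : ℂ} (hz : z.im ≠ 0) :
    Continuous (fun t : ℝ => ((t : ℂ) - z)⁻¹ - (t : ℂ) / (1 + (t : ℂ) ^ 2)) := by
  refine Continuous.sub ?_ ?_
  · exact (Complex.continuous_ofReal.sub continuous_const).inv₀ (ofReal_sub_ne_zero hz)
  · exact Complex.continuous_ofReal.div (continuous_const.add (Complex.continuous_ofReal.pow 2))
      one_add_ofReal_sq_ne_zero

/-- **Integrability of the Nevanlinna kernel** against a measure with `∫ dμ/(1+t²) < ∞`, for
`Im z ≠ 0`. [cite: RosenblumRovnyak1985, Appendix Section 6 Theorem B] -/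
theorem integrable_nevanlinnaKernel {μ : Measure ℝ} (hμ : Integrable (fun t : ℝ => (1 + t ^ 2)⁻¹) μ)
    {z : ℂ} (hz : z.im ≠ 0) :
    Integrable (fun t : ℝ => ((t : ℂ) - z)⁻¹ - (t : ℂ) / (1 + (t : ℂ) ^ 2)) μ :=
  Integrable.mono' (hμ.const_mul _) (continuous_nevanlinnaKernel hz).aestronglyMeasurable
    (ae_of_all _ (norm_nevanlinnaKernel_le hz))

/-- The imaginary part of the Nevanlinna kernel is the Poisson kernel:
`Im (1/(t-z) - t/(1+t²)) = Im z / ((t - Re z)² + (Im z)²)`. [folklore] -/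
lemma nevanlinnaKernel_im (z : ℂ) (t : ℝ) :
    (((t : ℂ) - z)⁻¹ - (t : ℂ) / (1 + (t : ℂ) ^ 2)).im = z.im / ((t - z.re) ^ 2 + z.im ^ 2) := by
  have h2 : (t : ℂ) / (1 + (t : ℂ) ^ 2) = ((t / (1 + t ^ 2) : ℝ) : ℂ) := by push_cast; ring
  rw [Complex.sub_im, h2, Complex.ofReal_im, sub_zero, Complex.inv_im, Complex.normSq_apply]
  simp only [Complex.sub_im, Complex.ofReal_im, Complex.sub_re, Complex.ofReal_re, zero_sub,
    neg_neg]
  ring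

/-! ### The imaginary part of a function in Nevanlinna form -/

/-- **Imaginary part in Nevanlinna's representation**: if
`f(z) = b + c z + π⁻¹ ∫ (1/(t-z) - t/(1+t²)) dμ(t)` with real `b, c` and `∫ dμ/(1+t²) < ∞`, then
`Im f(z) = c · Im z + π⁻¹ ∫ Im z/((t - Re z)² + (Im z)²) dμ(t)` for `Im z ≠ 0`.
[cite: RosenblumRovnyak1985, Appendix Section 6 Theorem B] -/
theorem im_eq_of_nevanlinna_repr {μ : Measure ℝ} (hμ : Integrable (fun t : ℝ => (1 + t ^ 2)⁻¹) μ)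
    {b c : ℝ} {z w : ℂ} (hz : z.im ≠ 0)
    (hw : w = (b : ℂ) + (c : ℂ) * z +
      (Real.pi : ℂ)⁻¹ * ∫ t : ℝ, (((t : ℂ) - z)⁻¹ - (t : ℂ) / (1 + (t : ℂ) ^ 2)) ∂μ) :
    w.im = c * z.im + Real.pi⁻¹ * ∫ t : ℝ, z.im / ((t - z.re) ^ 2 + z.im ^ 2) ∂μ := by
  rw [hw]
  have hint := integrable_nevanlinnaKernel hμ hz
  have him : (∫ t : ℝ, (((t : ℂ) - z)⁻¹ - (t : ℂ) / (1 + (t : ℂ) ^ 2)) ∂μ).im =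
      ∫ t : ℝ, z.im / ((t - z.re) ^ 2 + z.im ^ 2) ∂μ := by
    rw [← RCLike.im_to_complex, ← integral_im hint]
    exact integral_congr_ae (ae_of_all _ fun t => by
      dsimp only
      rw [RCLike.im_to_complex, nevanlinnaKernel_im])
  have hpi : ((Real.pi : ℂ)⁻¹).im = 0 := by
    rw [← Complex.ofReal_inv, Complex.ofReal_im]
  have hpr : ((Real.pi : ℂ)⁻¹).re = Real.pi⁻¹ := by
    rw [← Complex.ofReal_inv, Complex.ofReal_re]
  simp only [Complex.add_im, Complex.ofReal_im, Complex.mul_im, Complex.ofReal_re, zero_mul,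
    add_zero, zero_add, hpi, hpr, him]

/-- `μ` is finite on bounded sets when `∫ dμ/(1+t²) < ∞`. [folklore] -/
lemma measure_closedBall_lt_top_of_integrable {μ : Measure ℝ}
    (hμ : Integrable (fun t : ℝ => (1 + t ^ 2)⁻¹) μ) (x r : ℝ) : μ (closedBall x r) < ⊤ := by
  set R := |x| + |r| with hR
  have hsub : closedBall x r ⊆ {t : ℝ | (1 + R ^ 2)⁻¹ ≤ (1 + t ^ 2)⁻¹} := by
    intro t ht
    rw [mem_closedBall, Real.dist_eq] at ht
    have ht' : |t| ≤ R := by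
      calc |t| = |(t - x) + x| := by ring_nf
        _ ≤ |t - x| + |x| := abs_add_le _ _
        _ ≤ |r| + |x| := by linarith [ht.trans (le_abs_self r)]
        _ = R := by rw [hR]; ring
    show (1 + R ^ 2)⁻¹ ≤ (1 + t ^ 2)⁻¹
    have : t ^ 2 ≤ R ^ 2 := by
      rw [← sq_abs t]
      exact pow_le_pow_left₀ (abs_nonneg t) ht' 2
    exact inv_anti₀ (by positivity) (by linarith)
  refine lt_of_le_of_lt (measure_mono hsub) ?_
  have h := hμ.measure_ge_lt_top (ε := (1 + R ^ 2)⁻¹) (by positivity)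
  exact h

/-- **Ball estimate.** In Nevanlinna's representation with `c ≥ 0`:
`μ([x - y, x + y]) ≤ 2πy · Im f(x + iy)` for `y > 0`.
[cite: KacKrein1974, Supplement I §S1.4] -/
theorem measure_closedBall_le_of_nevanlinna_repr {μ : Measure ℝ}
    (hμ : Integrable (fun t : ℝ => (1 + t ^ 2)⁻¹) μ) {b c : ℝ} (hc : 0 ≤ c) {x y : ℝ} (hy : 0 < y)
    {w : ℂ} (hw : w = (b : ℂ) + (c : ℂ) * ((x : ℂ) + y * Complex.I) +
      (Real.pi : ℂ)⁻¹ * ∫ t : ℝ, (((t : ℂ) - ((x : ℂ) + y * Complex.I))⁻¹ -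
        (t : ℂ) / (1 + (t : ℂ) ^ 2)) ∂μ) :
    (μ (closedBall x y)).toReal ≤ 2 * Real.pi * y * w.im := by
  set z : ℂ := (x : ℂ) + y * Complex.I with hzdef
  have hzim : z.im = y := by simp [hzdef]
  have hzre : z.re = x := by simp [hzdef]
  have hz : z.im ≠ 0 := by rw [hzim]; exact hy.ne'
  have him := im_eq_of_nevanlinna_repr hμ hz hw
  rw [hzim, hzre] at him
  -- the Poisson integral dominates the mass of the ball
  have hP : ∀ t : ℝ, 0 ≤ y / ((t - x) ^ 2 + y ^ 2) := fun t => by positivity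
  have hPint : Integrable (fun t : ℝ => y / ((t - x) ^ 2 + y ^ 2)) μ := by
    have h := (integrable_nevanlinnaKernel hμ hz).im
    refine h.congr (ae_of_all _ fun t => ?_)
    dsimp only
    rw [RCLike.im_to_complex, nevanlinnaKernel_im, hzim, hzre]
  have hball : ∀ t ∈ closedBall x y, (2 * y)⁻¹ ≤ y / ((t - x) ^ 2 + y ^ 2) := by
    intro t ht
    rw [mem_closedBall, Real.dist_eq] at ht
    have h1 : (t - x) ^ 2 ≤ y ^ 2 := by
      rw [← sq_abs]
      exact pow_le_pow_left₀ (abs_nonneg _) ht 2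
    rw [inv_eq_one_div, div_le_div_iff₀ (by positivity) (by positivity)]
    nlinarith
  have hfin := (measure_closedBall_lt_top_of_integrable hμ x y).ne
  have h1 : (2 * y)⁻¹ * (μ (closedBall x y)).toReal ≤ ∫ t, y / ((t - x) ^ 2 + y ^ 2) ∂μ := by
    have h := setIntegral_ge_of_const_le (measurableSet_closedBall (x := x) (ε := y)) hfin hball
      hPint.integrableOn
    rw [smul_eq_mul, measureReal_def, mul_comm] at h
    exact h.trans (setIntegral_le_integral hPint (ae_of_all _ hP))
  have h2 : Real.pi⁻¹ * ∫ t, y / ((t - x) ^ 2 + y ^ 2) ∂μ ≤ w.im := by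
    rw [him]
    nlinarith [mul_nonneg hc hy.le]
  have hpi := Real.pi_pos
  calc (μ (closedBall x y)).toReal
      = 2 * Real.pi * y * (Real.pi⁻¹ * ((2 * y)⁻¹ * (μ (closedBall x y)).toReal)) := by
        field_simp
    _ ≤ 2 * Real.pi * y * (Real.pi⁻¹ * ∫ t, y / ((t - x) ^ 2 + y ^ 2) ∂μ) := by gcongr
    _ ≤ 2 * Real.pi * y * w.im := by gcongr

/-! ### The support lemma -/

/-- **Support lemma** (density form of Stieltjes inversion). In Nevanlinna's representation with
`c ≥ 0`, if `Im f(x + iy) → 0` as `y ↓ 0` for every `x < 0` (e.g. `f` extends continuously and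
real-valued to `(-∞, 0)`), then the representing measure does not charge `(-∞, 0)`.
Proof: `μ([x-y,x+y]) ≤ 2πy Im f(x+iy) = o(y)` at every `x < 0`, so by the Besicovitch covering
theorem `μ ≤ ε · Lebesgue` on bounded subsets of `(-∞,0)` for every `ε > 0`.
[cite: KacKrein1974, Supplement I §S1.4] -/
theorem measure_Iio_eq_zero_of_nevanlinna_repr {μ : Measure ℝ}
    (hμ : Integrable (fun t : ℝ => (1 + t ^ 2)⁻¹) μ) {b c : ℝ} (hc : 0 ≤ c) {f : ℂ → ℂ}
    (hrep : ∀ z : ℂ, 0 < z.im → f z = (b : ℂ) + (c : ℂ) * z +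
      (Real.pi : ℂ)⁻¹ * ∫ t : ℝ, (((t : ℂ) - z)⁻¹ - (t : ℂ) / (1 + (t : ℂ) ^ 2)) ∂μ)
    (hlim : ∀ x : ℝ, x < 0 →
      Tendsto (fun y : ℝ => (f ((x : ℂ) + y * Complex.I)).im) (𝓝[>] 0) (𝓝 0)) :
    μ (Iio 0) = 0 := by
  -- `μ` is σ-finite (finite on balls)
  haveI : SigmaFinite μ := ⟨⟨⟨fun n => closedBall 0 n, fun _ => trivial,
    fun n => measure_closedBall_lt_top_of_integrable hμ 0 n, iUnion_closedBall_nat 0⟩⟩⟩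
  have hzero : ∀ n : ℕ, μ (Ioo (-(n : ℝ)) 0) = 0 := by
    intro n
    set s := Ioo (-(n : ℝ)) 0 with hs
    set U := Ioo (-((n : ℝ) + 1)) 0 with hU
    refine le_antisymm (ENNReal.le_of_forall_pos_le_add (fun ε hε _ => ?_)) bot_le
    rw [zero_add]
    set ε' : ℝ := (ε : ℝ) / (2 * ((n : ℝ) + 1)) with hε'
    have hε'0 : 0 < ε' := by positivity
    -- admissible radii: small balls inside `U` of `μ`-mass at most `ε' ·` length
    set F : ℝ → Set ℝ := fun x =>
      {r | (μ (closedBall x r)).toReal ≤ ε' * (2 * r) ∧ closedBall x r ⊆ U} with hF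
    have hFne : ∀ x ∈ s, ∀ δ > 0, (F x ∩ Ioo 0 δ).Nonempty := by
      intro x hx δ hδ
      have hρ : 0 < min (-x) (x + ((n : ℝ) + 1)) := lt_min (by linarith [hx.2]) (by linarith [hx.1])
      have h1 := (Metric.tendsto_nhds.1 (hlim x hx.2)) (ε' / Real.pi) (by positivity)
      have h2 : ∀ᶠ y in 𝓝[>] (0 : ℝ), y ∈ Ioo 0 (min δ (min (-x) (x + ((n : ℝ) + 1)))) :=
        Ioo_mem_nhdsGT (lt_min hδ hρ)
      obtain ⟨y, hy1, hy2⟩ := (h1.and h2).exists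
      have hy0 : 0 < y := hy2.1
      have hyδ : y < δ := lt_of_lt_of_le hy2.2 (min_le_left _ _)
      have hyx : y < -x := lt_of_lt_of_le hy2.2 ((min_le_right _ _).trans (min_le_left _ _))
      have hyn : y < x + ((n : ℝ) + 1) :=
        lt_of_lt_of_le hy2.2 ((min_le_right _ _).trans (min_le_right _ _))
      refine ⟨y, ⟨?_, ?_⟩, hy0, hyδ⟩
      · have hbound := measure_closedBall_le_of_nevanlinna_repr hμ hc hy0
          (hrep ((x : ℂ) + y * Complex.I) (by simpa using hy0))
        rw [Real.dist_eq, sub_zero] at hy1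
        have him : (f ((x : ℂ) + y * Complex.I)).im ≤ ε' / Real.pi :=
          (le_abs_self _).trans hy1.le
        calc (μ (closedBall x y)).toReal
            ≤ 2 * Real.pi * y * (f ((x : ℂ) + y * Complex.I)).im := hbound
          _ ≤ 2 * Real.pi * y * (ε' / Real.pi) := by gcongr
          _ = ε' * (2 * y) := by field_simp
      · intro t ht
        rw [mem_closedBall, Real.dist_eq, abs_le] at ht
        constructor <;> linarith [ht.1, ht.2]
    obtain ⟨t, r, htc, -, htr, hμ0, hdisj⟩ :=
      Besicovitch.exists_disjoint_closedBall_covering_ae μ F s hFne (fun _ => 1)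
        (fun _ _ => one_pos)
    -- `μ(s) ≤ Σ μ(balls) ≤ ε' · Lebesgue(⋃ balls) ≤ ε' · Lebesgue(U)`
    have hB : ∀ x ∈ t, μ (closedBall x (r x)) ≤
        ENNReal.ofReal ε' * volume (closedBall x (r x)) := by
      intro x hx
      have h := (htr x hx).1.1
      rw [Real.volume_closedBall, ← ENNReal.ofReal_mul hε'0.le,
        ← ENNReal.ofReal_toReal (measure_closedBall_lt_top_of_integrable hμ x (r x)).ne]
      exact ENNReal.ofReal_le_ofReal h
    have hsub : (⋃ x ∈ t, closedBall x (r x)) ⊆ U :=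
      iUnion₂_subset (fun x hx => (htr x hx).1.2)
    calc μ s ≤ μ (s ∩ ⋃ x ∈ t, closedBall x (r x)) + μ (s \ ⋃ x ∈ t, closedBall x (r x)) :=
          measure_le_inter_add_sdiff _ _ _
      _ ≤ μ (⋃ x ∈ t, closedBall x (r x)) := by
          rw [hμ0, add_zero]
          exact measure_mono inter_subset_right
      _ = ∑' x : t, μ (closedBall x (r x)) :=
          measure_biUnion htc hdisj (fun x _ => measurableSet_closedBall)
      _ ≤ ∑' x : t, ENNReal.ofReal ε' * volume (closedBall (x : ℝ) (r x)) :=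
          ENNReal.tsum_le_tsum (fun x => hB x x.2)
      _ = ENNReal.ofReal ε' * volume (⋃ x ∈ t, closedBall x (r x)) := by
          rw [ENNReal.tsum_mul_left,
            measure_biUnion htc hdisj (fun x _ => measurableSet_closedBall)]
      _ ≤ ENNReal.ofReal ε' * volume U := by gcongr
      _ = ENNReal.ofReal (ε' * ((n : ℝ) + 1)) := by
          rw [hU, Real.volume_Ioo, ← ENNReal.ofReal_mul hε'0.le]
          congr 1
          ring
      _ ≤ (ε : ℝ≥0∞) := by
          rw [← ENNReal.ofReal_coe_nnreal]
          refine ENNReal.ofReal_le_ofReal ?_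
          rw [hε']
          have : (ε : ℝ) / (2 * ((n : ℝ) + 1)) * ((n : ℝ) + 1) = (ε : ℝ) / 2 := by field_simp
          rw [this]
          linarith [ε.coe_nonneg]
  rw [show Iio (0 : ℝ) = ⋃ n : ℕ, Ioo (-(n : ℝ)) 0 from ?_]
  · exact measure_iUnion_null hzero
  · ext x
    simp only [mem_Iio, mem_iUnion, mem_Ioo]
    constructor
    · intro hx
      obtain ⟨n, hn⟩ := exists_nat_gt (-x)
      exact ⟨n, by linarith, hx⟩
    · rintro ⟨n, -, hx⟩
      exact hx

end Literature.Analysis.InverseSpectral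

end
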